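import Literature.Geometry.Symplectic.SteinHandleProfileTail
import HarnessLib

/-!
# Assembling Eliashberg's handle profile, III: the slope near the three junctions as `ω → 0`

Topic `Literature/Geometry/Symplectic`; proofs file of the fact seat of
`Literature.Geometry.Symplectic.Gompf1998_thm13_twoHandles` (**E2**, `SteinTwoHandles.lean`),
sequel of `SteinHandleProfileAssembly.lean` and `SteinHandleProfileTail.lean`.  The `C^∞`
variant of the profile of Forstnerič–Kozak's Prop. 3.1 (= Eliashberg 1990, Lemma 3.4.3) glues
the second derivatives of its four pieces across windows of relative half-width `ω` at the
junctions `t₂` (slope `2`), `η` (slope `c₁`) and `ε` (slope `g'(ε)`).  This file proves that,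
as `ω → 0⁺`, the slope `fp ω β` of the assembled profile is uniformly close, on each window, to
the slope of the ideal piecewise profile at the junction, that the offset `δ₁(ω)` of the
descending law and the correction parameter `β⋆(ω)` tend to `0` — the quantitative content of
Forstnerič–Kozak's *"This does not change `h` and `h'` very much"* for this construction:

* §1 generic helpers (bounds near a point of continuity, window integrals, limits along
  `ω ↦ a(1 ± ω)`);
* §2 `φ` on the three windows is a convex combination of the two adjacent pieces
  (`φ_win₁`, `φ_win₂`, `φ_win₃`), and `fp ω β = fp ω 0` on `t ≤ 3ε/10` (`fp_indep_β`);
* §3 the junction `t₂`: `fp → 2` uniformly on the window (`fp_win₁_tendsto`), and the offset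
  `δ₁ ω = fp(t₂(1+ω)) - descSlope(t₂(1+ω)) → 0` (`δ₁_tendsto`);
* §4 the junction `η`: `fp → c₁` uniformly on the window (`fp_win₂_tendsto`);
* §5 the convex region: `fp ω β t = fp(a₃) + P₁(t) - P₁(a₃) + β ∫_{a₃}^t ψ`
  (`fp_convex_eq`, `P₁` the ideal slope `c₁ + A(t-η) + B(t-η)²/2`, `P₁(ε) = g'(ε)`);
* §6 the junction `ε`: `β⋆ ω → 0` (`βs_tendsto`) and `fp ω β⋆ → g'(ε)` uniformly on the window
  (`fp_win₃_tendsto`).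

Everything is **proved**; two definitions (`δ₁`, `P₁`), no named fact.

## References

* F. Forstnerič, J. Kozak, *Strongly pseudoconvex handlebodies*, J. Korean Math. Soc. 40
  (2003), 727–745 (arXiv:math/0305237), Prop. 3.1 and its proof. [ForstnericKozak2003]
* Ya. Eliashberg, *Topological characterization of Stein manifolds of dimension > 2*,
  Internat. J. Math. 1 (1990), 29–46, Lemma 3.4.3. [Eliashberg1990Stein]
-/

noncomputable section

open Set Filter MeasureTheory intervalIntegral
open scoped Topology ContDiff

namespace Literature.Geometry.Symplectic

/-! ### §1 Generic helpers -/

/-- A function continuous at `a` is bounded near `a`. [folklore] -/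
theorem exists_abs_le_near {Q : ℝ → ℝ} {a : ℝ} (hQ : ContinuousAt Q a) :
    ∃ ρ > 0, ∀ x, |x - a| < ρ → |Q x| ≤ |Q a| + 1 := by
  have h := Metric.continuousAt_iff.1 hQ 1 one_pos
  obtain ⟨ρ, hρ, hball⟩ := h
  refine ⟨ρ, hρ, fun x hx => ?_⟩
  have h1 : dist (Q x) (Q a) < 1 := hball (by rwa [Real.dist_eq])
  rw [Real.dist_eq] at h1
  have := abs_sub_abs_le_abs_sub (Q x) (Q a)
  linarith

/-- A function continuous at `a` is within `δ` of `Q a` near `a`. [folklore] -/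
theorem exists_abs_sub_lt_near {Q : ℝ → ℝ} {a δ : ℝ} (hQ : ContinuousAt Q a) (hδ : 0 < δ) :
    ∃ ρ > 0, ∀ x, |x - a| < ρ → |Q x - Q a| < δ := by
  obtain ⟨ρ, hρ, hball⟩ := Metric.continuousAt_iff.1 hQ δ hδ
  exact ⟨ρ, hρ, fun x hx => by have := hball (by rwa [Real.dist_eq]); rwa [Real.dist_eq] at this⟩

/-- **Window integrals are small**: `|∫_u^v φ| ≤ M |v - u|` if `|φ| ≤ M` on `[u, v]`.
[folklore] -/
theorem abs_integral_le_of_abs_le {φ : ℝ → ℝ} {u v M : ℝ} (h : ∀ x ∈ uIcc u v, |φ x| ≤ M) :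
    |∫ x in u..v, φ x| ≤ M * |v - u| := by
  have := norm_integral_le_of_norm_le_const (f := φ) (a := u) (b := v) (C := M)
    fun x hx => by rw [Real.norm_eq_abs]; exact h x (uIoc_subset_uIcc hx)
  rwa [Real.norm_eq_abs] at this

/-- `ω ↦ a(1 - ω)` and `ω ↦ a(1 + ω)` tend to `a` as `ω → 0⁺`; composed with a function
continuous at `a`. [folklore] -/
theorem tendsto_comp_one_sub {Q : ℝ → ℝ} {a : ℝ} (hQ : ContinuousAt Q a) :
    Tendsto (fun om => Q (a * (1 - om))) (𝓝[>] 0) (𝓝 (Q a)) := by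
  have h1 : Tendsto (fun om : ℝ => a * (1 - om)) (𝓝 0) (𝓝 a) := by
    have : Continuous fun om : ℝ => a * (1 - om) := by continuity
    simpa using this.tendsto 0
  exact (hQ.tendsto.comp h1).mono_left nhdsWithin_le_nhds

/-- Same with `a(1 + ω)`. [folklore] -/
theorem tendsto_comp_one_add {Q : ℝ → ℝ} {a : ℝ} (hQ : ContinuousAt Q a) :
    Tendsto (fun om => Q (a * (1 + om))) (𝓝[>] 0) (𝓝 (Q a)) := by
  have h1 : Tendsto (fun om : ℝ => a * (1 + om)) (𝓝 0) (𝓝 a) := by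
    have : Continuous fun om : ℝ => a * (1 + om) := by continuity
    simpa using this.tendsto 0
  exact (hQ.tendsto.comp h1).mono_left nhdsWithin_le_nhds

/-- `0 < ω` eventually along `𝓝[>] 0`, and `ω < c` for any `c > 0`. [folklore] -/
theorem eventually_pos_lt {c : ℝ} (hc : 0 < c) : ∀ᶠ om : ℝ in 𝓝[>] 0, 0 < om ∧ om < c := by
  have h1 : ∀ᶠ om : ℝ in 𝓝[>] 0, 0 < om := self_mem_nhdsWithin
  have h2 : ∀ᶠ om : ℝ in 𝓝[>] 0, om < c :=
    nhdsWithin_le_nhds (Iio_mem_nhds hc)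
  exact h1.and h2

/-- The bound of a convex combination by the sum of the absolute values. [folklore] -/
theorem abs_glue_le {χ x y : ℝ} (h0 : 0 ≤ χ) (h1 : χ ≤ 1) : |(1 - χ) * x + χ * y| ≤ |x| + |y| := by
  calc |(1 - χ) * x + χ * y| ≤ |(1 - χ) * x| + |χ * y| := abs_add_le _ _
    _ = (1 - χ) * |x| + χ * |y| := by rw [abs_mul, abs_mul, abs_of_nonneg (by linarith), abs_of_nonneg h0]
    _ ≤ |x| + |y| := by nlinarith [abs_nonneg x, abs_nonneg y]

namespace HParam

variable {P : HParam}

/-! ### §2 `φ` on the windows; independence of `β` on `t ≤ 3ε/10` -/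

/-- Sizes: `t₂(1+ω) ≤ η(1-ω)`, `η(1+ω) ≤ 3ε/10 ≤ ε(1-ω)` for `0 ≤ ω ≤ 1/8`. [folklore] -/
theorem Pos.sizes (h : P.Pos) {om : ℝ} (hom0 : 0 ≤ om) (hom8 : om ≤ 1 / 8) :
    P.t₂ * (1 + om) ≤ P.η * (1 - om) ∧ P.η * (1 + om) ≤ 3 * P.ε / 10 ∧ 3 * P.ε / 10 ≤ P.ε * (1 - om) := by
  have h1 := h.t₂_lt_half_η; have h2 := h.η_lt; have h3 := h.ε_pos; have h4 := h.η_pos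
  refine ⟨by nlinarith, by nlinarith, by nlinarith⟩

/-- **On the first window `φ` is a convex combination of `Q₀` and `Q₂`.** [folklore] -/
theorem φ_win₁ (h : P.Pos) {om : ℝ} (hom : 0 < om) (hom8 : om ≤ 1 / 8) (β : ℝ) {x : ℝ}
    (hx : x ≤ P.t₂ * (1 + om)) :
    P.φ om β x = (1 - window P.t₂ om x) * P.Q₀ x + window P.t₂ om x * P.Q₂ x := by
  obtain ⟨s1, s2, -⟩ := h.sizes hom.le hom8
  have hw2 : window P.η om x = 0 := window_zero_of_le h.η_pos hom (hx.trans s1)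
  have hψ : P.ψ x = 0 := ψ_zero_of_le h (by nlinarith [h.η_pos])
  rw [φ, hw2, hψ]; ring

/-- **On the second window `φ` is a convex combination of `Q₂` and `Q₁`.** [folklore] -/
theorem φ_win₂ (h : P.Pos) {om : ℝ} (hom : 0 < om) (hom8 : om ≤ 1 / 8) (β : ℝ) {x : ℝ}
    (hx1 : P.η * (1 - om) ≤ x) (hx2 : x ≤ P.η * (1 + om)) :
    P.φ om β x = (1 - window P.η om x) * P.Q₂ x + window P.η om x * P.Q₁ x := by
  obtain ⟨s1, s2, s3⟩ := h.sizes hom.le hom8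
  have hw1 : window P.t₂ om x = 1 := window_one_of_ge h.t₂_pos hom (s1.trans hx1)
  have hw3 : window P.ε om x = 0 := window_zero_of_le h.ε_pos hom (hx2.trans (s2.trans s3))
  have hψ : P.ψ x = 0 := ψ_zero_of_le h (hx2.trans s2)
  rw [φ, hw1, hw3, hψ]; ring

/-- **On the third window `φ` is a convex combination of `Q₁` and `Q_g`.** [folklore] -/
theorem φ_win₃ (h : P.Pos) {om : ℝ} (hom : 0 < om) (hom8 : om ≤ 1 / 8) (β : ℝ) {x : ℝ}
    (hx1 : P.ε * (1 - om) ≤ x) :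
    P.φ om β x = (1 - window P.ε om x) * P.Q₁ x + window P.ε om x * P.Qg x := by
  obtain ⟨s1, s2, s3⟩ := h.sizes hom.le hom8
  have hε := h.ε_pos
  have hη' : P.η * (1 - om) ≤ P.η * (1 + om) := by nlinarith [h.η_pos]
  have hw1 : window P.t₂ om x = 1 := window_one_of_ge h.t₂_pos hom (by linarith)
  have hw2 : window P.η om x = 1 := window_one_of_ge h.η_pos hom (by linarith)
  have hψ : P.ψ x = 0 := ψ_zero_of_ge h (by nlinarith)
  rw [φ, hw1, hw2, hψ]; ring

/-- **`f'` does not depend on `β` left of the bump**: `fp ω β t = fp ω 0 t` for `σ < t ≤ 3ε/10`.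
[folklore] -/
theorem fp_indep_β (h : P.Pos) {om : ℝ} (hom : 0 < om) (hom8 : om ≤ 1 / 8) (β : ℝ) {t : ℝ}
    (ht : P.σ < t) (ht3 : t ≤ 3 * P.ε / 10) : P.fp om β t = P.fp om 0 t := by
  rw [fp_eq_add_mul h hom hom8 β ht]
  have htL : P.tL ≤ 3 * P.ε / 10 := by rw [tL_eq]; linarith [h.σ_lt_ε]
  have h0 : ∫ x in P.tL..t, P.ψ x = 0 := by
    rw [integral_congr (g := fun _ => (0 : ℝ)) fun x hx => ?_, intervalIntegral.integral_zero]
    apply ψ_zero_of_le h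
    rcases le_total P.tL t with hle | hle
    · rw [uIcc_of_le hle] at hx; exact hx.2.trans ht3
    · rw [uIcc_of_ge hle] at hx; exact hx.2.trans htL
  rw [h0, mul_zero, add_zero]

/-! ### §3 The junction `t₂` -/

/-- `P₀(t₂) = 2`: the start piece reaches slope `2` at `t₂ = 2σ`. [cite: ForstnericKozak2003, Prop. 3.1] -/
theorem P₀_t₂ (h : P.Pos) : P.P₀ P.t₂ = 2 := by
  have hσ := h.σ_pos
  rw [P₀, startSlope, t₂_eq, show 2 * P.σ - P.σ = P.σ by ring, startLog, div_self hσ.ne',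
    Real.log_one, add_zero]
  field_simp

/-- `descSlope(t₂) = 2`. [cite: ForstnericKozak2003, Prop. 3.1] -/
theorem descSlope_t₂ (h : P.Pos) : descSlope P.Cc P.η P.t₂ = 2 := descSlope_junction h.η_pos

/-- `descSlope(η) = c₁` (`C = c₁⁻²`). [cite: ForstnericKozak2003, Prop. 3.1] -/
theorem descSlope_η (h : P.Pos) : descSlope P.Cc P.η P.η = P.c₁ := by
  rw [descSlope_self h.η_pos, Cc, Real.sqrt_div' _ (sq_nonneg _), Real.sqrt_one,
    Real.sqrt_sq h.c₁_pos.le]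
  field_simp

/-- `P₀` is continuous at `t₂`; `Q₀`, `Q₂`, `descSlope` are continuous at `t₂`. [folklore] -/
theorem continuousAt_t₂ (h : P.Pos) :
    ContinuousAt P.P₀ P.t₂ ∧ ContinuousAt P.Q₀ P.t₂ ∧ ContinuousAt P.Q₂ P.t₂ ∧
      ContinuousAt (descSlope P.Cc P.η) P.t₂ := by
  have hσ := h.σ_pos
  have ht₂ := t₂_eq P
  have hmem : P.t₂ ∈ Ioo P.σ (3 * P.σ) := by rw [ht₂]; constructor <;> linarith
  have hmem' : P.t₂ ∈ Ioi (8 * P.σ / 5) := by show 8 * P.σ / 5 < P.t₂; rw [ht₂]; linarith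
  exact ⟨((contDiffOn_P₀ h (n := ⊤)).continuousOn.continuousAt (Ioo_mem_nhds hmem.1 hmem.2)),
    ((contDiffOn_Q₀ h (n := ⊤)).continuousOn.continuousAt (Ioo_mem_nhds hmem.1 hmem.2)),
    ((contDiffOn_Q₂ h (n := ⊤)).continuousOn.continuousAt (Ioi_mem_nhds hmem')),
    ((contDiffOn_descSlope h (n := ⊤)).continuousOn.continuousAt (Ioi_mem_nhds hmem'))⟩

/-- **The slope on the first window**: for `t₂(1-ω) ≤ t ≤ t₂(1+ω)`,
`fp ω β t = P₀(t₂(1-ω)) + ∫_{t₂(1-ω)}^t φ` with `|φ| ≤ |Q₀| + |Q₂|` on the window. [folklore] -/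
theorem fp_win₁_eq (h : P.Pos) {om : ℝ} (hom : 0 < om) (hom8 : om ≤ 1 / 8) (β : ℝ) {t : ℝ}
    (ht1 : P.t₂ * (1 - om) ≤ t) :
    P.fp om β t = P.P₀ (P.t₂ * (1 - om)) + ∫ x in (P.t₂ * (1 - om))..t, P.φ om β x := by
  have hσ := h.σ_pos
  have ht₂ := t₂_eq P
  have ha : P.σ < P.t₂ * (1 - om) := by rw [ht₂]; nlinarith
  have hσx : ∀ x ∈ uIcc (P.t₂ * (1 - om)) t, P.σ < x := fun x hx => by
    rw [uIcc_of_le ht1] at hx; linarith [hx.1]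
  have hderiv : ∀ x ∈ uIcc (P.t₂ * (1 - om)) t, HasDerivAt (P.fp om β) (P.φ om β x) x := fun x hx =>
    hasDerivAt_fp h hom hom8 β (hσx x hx)
  have hint : IntervalIntegrable (P.φ om β) volume (P.t₂ * (1 - om)) t :=
    ((contDiffOn_phi h hom hom8 β (n := ⊤)).continuousOn.mono fun x hx => hσx x hx).intervalIntegrable
  have hI := integral_eq_sub_of_hasDerivAt hderiv hint
  rw [fp_eq_P₀ h hom hom8 β ha le_rfl] at hI
  linarith

/-- **`fp → 2` uniformly on the first window as `ω → 0⁺`** (for any `β`). [cite: ForstnericKozak2003, Prop. 3.1] -/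
theorem fp_win₁_tendsto (h : P.Pos) (β : ℝ) {δ : ℝ} (hδ : 0 < δ) :
    ∀ᶠ om in 𝓝[>] 0, ∀ t ∈ Icc (P.t₂ * (1 - om)) (P.t₂ * (1 + om)), |P.fp om β t - 2| < δ := by
  have ht₂ := h.t₂_pos
  obtain ⟨hcP, hcQ0, hcQ2, -⟩ := continuousAt_t₂ h
  obtain ⟨ρ0, hρ0, hb0⟩ := exists_abs_le_near hcQ0
  obtain ⟨ρ2, hρ2, hb2⟩ := exists_abs_le_near hcQ2
  set M := |P.Q₀ P.t₂| + 1 + (|P.Q₂ P.t₂| + 1) with hM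
  have hM0 : 0 < M := by rw [hM]; positivity
  -- `P₀(t₂(1-om)) → 2`
  have hP : Tendsto (fun om => P.P₀ (P.t₂ * (1 - om))) (𝓝[>] 0) (𝓝 2) := by
    rw [← P₀_t₂ h]; exact tendsto_comp_one_sub hcP
  have hP' : ∀ᶠ om in 𝓝[>] 0, |P.P₀ (P.t₂ * (1 - om)) - 2| < δ / 2 := by
    have := (Metric.tendsto_nhds.1 hP) (δ / 2) (by linarith)
    filter_upwards [this] with om hom; rwa [Real.dist_eq] at hom
  have hsmall : ∀ᶠ om : ℝ in 𝓝[>] 0, 0 < om ∧ om < min (1 / 8) (min (ρ0 / P.t₂) (min (ρ2 / P.t₂) (δ / (4 * P.t₂ * M + 1)))) :=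
    eventually_pos_lt (by positivity)
  filter_upwards [hP', hsmall] with om h1 h2 t ht
  obtain ⟨hom, hlt⟩ := h2
  simp only [lt_min_iff] at hlt
  obtain ⟨hom8, hρ0', hρ2', hδ'⟩ := hlt
  -- bound on `|φ|` over the window
  have hwin : ∀ x ∈ uIcc (P.t₂ * (1 - om)) t, |P.φ om β x| ≤ M := by
    intro x hx
    rw [uIcc_of_le ht.1] at hx
    have hx2 : x ≤ P.t₂ * (1 + om) := hx.2.trans ht.2
    have hxa : |x - P.t₂| ≤ om * P.t₂ := by
      rw [abs_le]; constructor <;> nlinarith [hx.1, hx2]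
    have hx0 : |x - P.t₂| < ρ0 := lt_of_le_of_lt hxa (by rwa [lt_div_iff₀ ht₂] at hρ0')
    have hx2' : |x - P.t₂| < ρ2 := lt_of_le_of_lt hxa (by rwa [lt_div_iff₀ ht₂] at hρ2')
    rw [φ_win₁ h hom hom8.le β hx2]
    exact (abs_glue_le (window_nonneg x) (window_le_one x)).trans (add_le_add (hb0 x hx0) (hb2 x hx2'))
  have hI : |∫ x in (P.t₂ * (1 - om))..t, P.φ om β x| ≤ M * |t - P.t₂ * (1 - om)| :=
    abs_integral_le_of_abs_le hwin
  have hlen : |t - P.t₂ * (1 - om)| ≤ 2 * om * P.t₂ := by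
    rw [abs_of_nonneg (by linarith [ht.1])]; nlinarith [ht.2]
  have hI' : |∫ x in (P.t₂ * (1 - om))..t, P.φ om β x| < δ / 2 := by
    have h3 : M * |t - P.t₂ * (1 - om)| ≤ M * (2 * om * P.t₂) := mul_le_mul_of_nonneg_left hlen hM0.le
    have h4 : om * (4 * P.t₂ * M + 1) < δ := by rwa [lt_div_iff₀ (by positivity)] at hδ'
    nlinarith
  rw [fp_win₁_eq h hom hom8.le β ht.1]
  calc |P.P₀ (P.t₂ * (1 - om)) + (∫ x in (P.t₂ * (1 - om))..t, P.φ om β x) - 2|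
        = |(P.P₀ (P.t₂ * (1 - om)) - 2) + ∫ x in (P.t₂ * (1 - om))..t, P.φ om β x| := by ring_nf
    _ ≤ |P.P₀ (P.t₂ * (1 - om)) - 2| + |∫ x in (P.t₂ * (1 - om))..t, P.φ om β x| := abs_add_le _ _
    _ < δ / 2 + δ / 2 := add_lt_add h1 hI'
    _ = δ := by ring

/-- **The offset of the descending law** `δ₁ ω β = fp ω β (t₂(1+ω)) - descSlope(t₂(1+ω))`; on the
descending region `fp = descSlope + δ₁` (`fp_sub_descSlope_eq`). [folklore] -/
def δ₁ (P : HParam) (om β : ℝ) : ℝ := P.fp om β (P.t₂ * (1 + om)) - descSlope P.Cc P.η (P.t₂ * (1 + om))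

/-- **`fp = descSlope + δ₁` on the descending region** `t₂(1+ω) ≤ t ≤ η(1-ω)`. [cite: ForstnericKozak2003, Prop. 3.1] -/
theorem fp_desc (h : P.Pos) {om : ℝ} (hom : 0 < om) (hom8 : om ≤ 1 / 8) (β : ℝ) {t : ℝ}
    (h1 : P.t₂ * (1 + om) ≤ t) (h2 : t ≤ P.η * (1 - om)) :
    P.fp om β t = descSlope P.Cc P.η t + P.δ₁ om β := by
  have s1 := (h.sizes hom.le hom8).1
  have := fp_sub_descSlope_eq h hom hom8 β h1 h2 le_rfl s1
  rw [δ₁]; linarith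

/-- **`δ₁ → 0` as `ω → 0⁺`.** [cite: ForstnericKozak2003, Prop. 3.1] -/
theorem δ₁_tendsto (h : P.Pos) (β : ℝ) : Tendsto (fun om => P.δ₁ om β) (𝓝[>] 0) (𝓝 0) := by
  obtain ⟨-, -, -, hcd⟩ := continuousAt_t₂ h
  have hd : Tendsto (fun om => descSlope P.Cc P.η (P.t₂ * (1 + om))) (𝓝[>] 0) (𝓝 2) := by
    rw [← descSlope_t₂ h]; exact tendsto_comp_one_add hcd
  rw [Metric.tendsto_nhds]
  intro δ hδ
  have h1 := fp_win₁_tendsto h β (half_pos hδ)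
  have h2 := (Metric.tendsto_nhds.1 hd) (δ / 2) (half_pos hδ)
  have h3 : ∀ᶠ om : ℝ in 𝓝[>] 0, 0 < om := self_mem_nhdsWithin
  filter_upwards [h1, h2, h3] with om h1 h2 h3
  have ht : P.t₂ * (1 + om) ∈ Icc (P.t₂ * (1 - om)) (P.t₂ * (1 + om)) :=
    ⟨by nlinarith [h.t₂_pos], le_rfl⟩
  have h4 := h1 _ ht
  rw [Real.dist_eq] at h2 ⊢
  rw [δ₁, sub_zero]
  calc |P.fp om β (P.t₂ * (1 + om)) - descSlope P.Cc P.η (P.t₂ * (1 + om))|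
        = |(P.fp om β (P.t₂ * (1 + om)) - 2) - (descSlope P.Cc P.η (P.t₂ * (1 + om)) - 2)| := by ring_nf
    _ ≤ |P.fp om β (P.t₂ * (1 + om)) - 2| + |descSlope P.Cc P.η (P.t₂ * (1 + om)) - 2| := abs_sub _ _
    _ < δ / 2 + δ / 2 := add_lt_add h4 h2
    _ = δ := by ring

/-! ### §4 The junction `η` -/

/-- `descSlope`, `Q₂` are continuous at `η`; `Q₁` is continuous. [folklore] -/
theorem continuousAt_η (h : P.Pos) :
    ContinuousAt (descSlope P.Cc P.η) P.η ∧ ContinuousAt P.Q₂ P.η ∧ ContinuousAt P.Q₁ P.η := by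
  have hmem : P.η ∈ Ioi (8 * P.σ / 5) := by
    show 8 * P.σ / 5 < P.η
    have := h.t₂_lt_half_η; rw [t₂_eq] at this; linarith [h.σ_pos]
  exact ⟨(contDiffOn_descSlope h (n := ⊤)).continuousOn.continuousAt (Ioi_mem_nhds hmem),
    (contDiffOn_Q₂ h (n := ⊤)).continuousOn.continuousAt (Ioi_mem_nhds hmem),
    (contDiff_Q₁ (P := P) (n := ⊤)).continuous.continuousAt⟩

/-- **The slope on the second window**: for `η(1-ω) ≤ t ≤ η(1+ω)`,
`fp ω β t = descSlope(η(1-ω)) + δ₁ + ∫_{η(1-ω)}^t φ`. [folklore] -/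
theorem fp_win₂_eq (h : P.Pos) {om : ℝ} (hom : 0 < om) (hom8 : om ≤ 1 / 8) (β : ℝ) {t : ℝ}
    (ht1 : P.η * (1 - om) ≤ t) :
    P.fp om β t = descSlope P.Cc P.η (P.η * (1 - om)) + P.δ₁ om β +
      ∫ x in (P.η * (1 - om))..t, P.φ om β x := by
  obtain ⟨s1, -, -⟩ := h.sizes hom.le hom8
  have hσ := h.σ_pos
  have ha : P.σ < P.η * (1 - om) := by
    have := h.t₂_pos; rw [t₂_eq] at s1 this; nlinarith
  have hσx : ∀ x ∈ uIcc (P.η * (1 - om)) t, P.σ < x := fun x hx => by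
    rw [uIcc_of_le ht1] at hx; linarith [hx.1]
  have hderiv : ∀ x ∈ uIcc (P.η * (1 - om)) t, HasDerivAt (P.fp om β) (P.φ om β x) x := fun x hx =>
    hasDerivAt_fp h hom hom8 β (hσx x hx)
  have hint : IntervalIntegrable (P.φ om β) volume (P.η * (1 - om)) t :=
    ((contDiffOn_phi h hom hom8 β (n := ⊤)).continuousOn.mono fun x hx => hσx x hx).intervalIntegrable
  have hI := integral_eq_sub_of_hasDerivAt hderiv hint
  rw [fp_desc h hom hom8 β s1 le_rfl] at hI
  linarith

/-- **`fp → c₁` uniformly on the second window as `ω → 0⁺`** (for any `β`). [cite: ForstnericKozak2003, Prop. 3.1] -/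
theorem fp_win₂_tendsto (h : P.Pos) (β : ℝ) {δ : ℝ} (hδ : 0 < δ) :
    ∀ᶠ om in 𝓝[>] 0, ∀ t ∈ Icc (P.η * (1 - om)) (P.η * (1 + om)), |P.fp om β t - P.c₁| < δ := by
  have hη := h.η_pos
  obtain ⟨hcd, hcQ2, hcQ1⟩ := continuousAt_η h
  obtain ⟨ρ2, hρ2, hb2⟩ := exists_abs_le_near hcQ2
  obtain ⟨ρ1, hρ1, hb1⟩ := exists_abs_le_near hcQ1
  set M := |P.Q₂ P.η| + 1 + (|P.Q₁ P.η| + 1) with hM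
  have hM0 : 0 < M := by rw [hM]; positivity
  have hd : Tendsto (fun om => descSlope P.Cc P.η (P.η * (1 - om))) (𝓝[>] 0) (𝓝 P.c₁) := by
    rw [← descSlope_η h]; exact tendsto_comp_one_sub hcd
  have hd' : ∀ᶠ om in 𝓝[>] 0, |descSlope P.Cc P.η (P.η * (1 - om)) - P.c₁| < δ / 3 := by
    have := (Metric.tendsto_nhds.1 hd) (δ / 3) (by linarith)
    filter_upwards [this] with om hom; rwa [Real.dist_eq] at hom
  have hδ₁ : ∀ᶠ om in 𝓝[>] 0, |P.δ₁ om β| < δ / 3 := by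
    have := (Metric.tendsto_nhds.1 (δ₁_tendsto h β)) (δ / 3) (by linarith)
    filter_upwards [this] with om hom; rwa [Real.dist_eq, sub_zero] at hom
  have hsmall : ∀ᶠ om : ℝ in 𝓝[>] 0, 0 < om ∧ om < min (1 / 8) (min (ρ2 / P.η) (min (ρ1 / P.η) (δ / (6 * P.η * M + 1)))) :=
    eventually_pos_lt (by positivity)
  filter_upwards [hd', hδ₁, hsmall] with om h1 h2 h3 t ht
  obtain ⟨hom, hlt⟩ := h3
  simp only [lt_min_iff] at hlt
  obtain ⟨hom8, hρ2', hρ1', hδ'⟩ := hlt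
  have hwin : ∀ x ∈ uIcc (P.η * (1 - om)) t, |P.φ om β x| ≤ M := by
    intro x hx
    rw [uIcc_of_le ht.1] at hx
    have hx2 : x ≤ P.η * (1 + om) := hx.2.trans ht.2
    have hxa : |x - P.η| ≤ om * P.η := by
      rw [abs_le]; constructor <;> nlinarith [hx.1, hx2]
    have hx2' : |x - P.η| < ρ2 := lt_of_le_of_lt hxa (by rwa [lt_div_iff₀ hη] at hρ2')
    have hx1' : |x - P.η| < ρ1 := lt_of_le_of_lt hxa (by rwa [lt_div_iff₀ hη] at hρ1')
    rw [φ_win₂ h hom hom8.le β hx.1 hx2]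
    exact (abs_glue_le (window_nonneg x) (window_le_one x)).trans (add_le_add (hb2 x hx2') (hb1 x hx1'))
  have hI : |∫ x in (P.η * (1 - om))..t, P.φ om β x| ≤ M * |t - P.η * (1 - om)| :=
    abs_integral_le_of_abs_le hwin
  have hlen : |t - P.η * (1 - om)| ≤ 2 * om * P.η := by
    rw [abs_of_nonneg (by linarith [ht.1])]; nlinarith [ht.2]
  have hI' : |∫ x in (P.η * (1 - om))..t, P.φ om β x| < δ / 3 := by
    have h3 : M * |t - P.η * (1 - om)| ≤ M * (2 * om * P.η) := mul_le_mul_of_nonneg_left hlen hM0.le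
    have h4 : om * (6 * P.η * M + 1) < δ := by rwa [lt_div_iff₀ (by positivity)] at hδ'
    nlinarith
  rw [fp_win₂_eq h hom hom8.le β ht.1]
  calc |descSlope P.Cc P.η (P.η * (1 - om)) + P.δ₁ om β + (∫ x in (P.η * (1 - om))..t, P.φ om β x) - P.c₁|
        = |(descSlope P.Cc P.η (P.η * (1 - om)) - P.c₁) + P.δ₁ om β +
            ∫ x in (P.η * (1 - om))..t, P.φ om β x| := by ring_nf
    _ ≤ |descSlope P.Cc P.η (P.η * (1 - om)) - P.c₁| + |P.δ₁ om β| +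
          |∫ x in (P.η * (1 - om))..t, P.φ om β x| := abs_add_three _ _ _
    _ < δ / 3 + δ / 3 + δ / 3 := by linarith
    _ = δ := by ring

/-! ### §5 The convex region: the ideal slope `P₁` -/

/-- **The ideal slope on the convex region** `P₁(t) = c₁ + A(t - η) + B(t - η)²/2`
(`P₁' = Q₁`, `P₁(η) = c₁`, `P₁(ε) = g'(ε)`). [cite: ForstnericKozak2003, Prop. 3.1] -/
def P₁ (P : HParam) (t : ℝ) : ℝ := P.c₁ + P.A * (t - P.η) + P.B * (t - P.η) ^ 2 / 2

/-- `P₁' = Q₁`. [folklore] -/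
theorem hasDerivAt_P₁ (t : ℝ) : HasDerivAt P.P₁ (P.Q₁ t) t := by
  have h1 : HasDerivAt (fun t => t - P.η) 1 t := (hasDerivAt_id' t).sub_const _
  have h2 := ((h1.pow 2).const_mul P.B).div_const 2
  have h3 := (h1.const_mul P.A).const_add P.c₁
  have h4 := h3.add h2
  refine (h4.congr_of_eventuallyEq (Eventually.of_forall fun t' => by simp [P₁])).congr_deriv ?_
  simp [Q₁]; ring

/-- `P₁(η) = c₁`. [folklore] -/
theorem P₁_η : P.P₁ P.η = P.c₁ := by simp [P₁]

/-- **`P₁(ε) = g'(ε)`**: the definition of `c₁` makes the ideal slope continuous at `ε`.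
[cite: ForstnericKozak2003, Prop. 3.1] -/
theorem P₁_ε (h : P.Pos) : P.P₁ P.ε = P.gpε := by
  have hne : P.ε - P.η ≠ 0 := by have := h.η_lt; have := h.ε_pos; linarith [h.η_pos]
  rw [P₁, c₁, B]
  field_simp
  ring

/-- `P₁` is continuous. [folklore] -/
theorem continuous_P₁ : Continuous P.P₁ := by
  unfold P₁; fun_prop

/-- **The slope on the convex region**: for `η(1+ω) ≤ t ≤ ε(1-ω)`,
`fp ω β t = fp ω β (η(1+ω)) + P₁(t) - P₁(η(1+ω)) + β ∫_{η(1+ω)}^t ψ`. [cite: ForstnericKozak2003, Prop. 3.1] -/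
theorem fp_convex_eq (h : P.Pos) {om : ℝ} (hom : 0 < om) (hom8 : om ≤ 1 / 8) (β : ℝ) {t : ℝ}
    (h1 : P.η * (1 + om) ≤ t) (h2 : t ≤ P.ε * (1 - om)) :
    P.fp om β t = P.fp om β (P.η * (1 + om)) + (P.P₁ t - P.P₁ (P.η * (1 + om))) +
      β * ∫ x in (P.η * (1 + om))..t, P.ψ x := by
  set a := P.η * (1 + om) with ha
  have hσa : P.σ < a := by
    obtain ⟨s1, -, -⟩ := h.sizes hom.le hom8
    have := h.t₂_pos; rw [t₂_eq] at s1 this; rw [ha]; nlinarith [h.η_pos]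
  have hmem : ∀ x ∈ uIcc a t, a ≤ x ∧ x ≤ P.ε * (1 - om) := fun x hx => by
    rw [uIcc_of_le h1] at hx; exact ⟨hx.1, hx.2.trans h2⟩
  have hσx : ∀ x ∈ uIcc a t, P.σ < x := fun x hx => lt_of_lt_of_le hσa (hmem x hx).1
  have hderiv : ∀ x ∈ uIcc a t, HasDerivAt (P.fp om β) (P.φ om β x) x := fun x hx =>
    hasDerivAt_fp h hom hom8 β (hσx x hx)
  have hint : IntervalIntegrable (P.φ om β) volume a t :=
    ((contDiffOn_phi h hom hom8 β (n := ⊤)).continuousOn.mono fun x hx => hσx x hx).intervalIntegrable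
  have hI := integral_eq_sub_of_hasDerivAt hderiv hint
  have hcongr : ∫ x in a..t, P.φ om β x = ∫ x in a..t, (P.Q₁ x + β * P.ψ x) :=
    integral_congr fun x hx => φ_eq_Q₁_add h hom β (hmem x hx).1 (hmem x hx).2
  have hψc : Continuous P.ψ := (contDiff_ψ (n := ⊤)).continuous
  have hiQ : IntervalIntegrable P.Q₁ volume a t := (contDiff_Q₁ (P := P) (n := ⊤)).continuous.intervalIntegrable _ _
  have hiψ : IntervalIntegrable (fun x => β * P.ψ x) volume a t := (continuous_const.mul hψc).intervalIntegrable _ _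
  have hQ : ∫ x in a..t, P.Q₁ x = P.P₁ t - P.P₁ a :=
    integral_eq_sub_of_hasDerivAt (fun x _ => hasDerivAt_P₁ x) hiQ
  rw [hcongr, integral_add hiQ hiψ, hQ, intervalIntegral.integral_const_mul] at hI
  linarith

/-! ### §6 The junction `ε`: `β⋆ → 0` and the slope on the third window -/

/-- Continuity at `ε` of the pieces `Q₁`, `Q_g`, `g'`, `P₁`. [folklore] -/
theorem continuousAt_ε (h : P.Pos) :
    ContinuousAt P.Q₁ P.ε ∧ ContinuousAt P.Qg P.ε ∧
      ContinuousAt (fun t => P.l * t / quadric P.l t) P.ε ∧ ContinuousAt P.P₁ P.ε := by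
  have hl := h.l_nonneg
  refine ⟨(contDiff_Q₁ (P := P) (n := ⊤)).continuous.continuousAt,
    (contDiff_Qg h (n := ⊤)).continuous.continuousAt, ?_, continuous_P₁.continuousAt⟩
  exact (hasDerivAt_quadric hl P.ε |>.continuousAt |> fun hc =>
    ((continuous_const.mul continuous_id).continuousAt.div hc (quadric_pos hl _).ne'))

/-- `g'(ε) = gpε` (unfolding). [folklore] -/
theorem gp_ε : P.l * P.ε / quadric P.l P.ε = P.gpε := rfl

/-- **The discrepancy at `T`**: `g'(T) - fp ω 0 T → 0` as `ω → 0⁺`. [cite: ForstnericKozak2003, Prop. 3.1] -/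
theorem discrepancy_T_tendsto (h : P.Pos) :
    Tendsto (fun om => P.l * (P.ε * (1 + om)) / quadric P.l (P.ε * (1 + om)) - P.fp om 0 (P.ε * (1 + om)))
      (𝓝[>] 0) (𝓝 0) := by
  have hε := h.ε_pos
  have hl := h.l_nonneg
  obtain ⟨hcQ1, hcQg, hcg, hcP1⟩ := continuousAt_ε h
  obtain ⟨ρ1, hρ1, hb1⟩ := exists_abs_le_near hcQ1
  obtain ⟨ρg, hρg, hbg⟩ := exists_abs_le_near hcQg
  set M := |P.Q₁ P.ε| + 1 + (|P.Qg P.ε| + 1) with hM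
  have hM0 : 0 < M := by rw [hM]; positivity
  rw [Metric.tendsto_nhds]
  intro δ hδ
  -- `g'(b₃) - P₁(b₃) → 0`
  have hA : Tendsto (fun om => P.l * (P.ε * (1 - om)) / quadric P.l (P.ε * (1 - om)) - P.P₁ (P.ε * (1 - om)))
      (𝓝[>] 0) (𝓝 0) := by
    have h1 := tendsto_comp_one_sub hcg
    have h2 := tendsto_comp_one_sub hcP1
    have := h1.sub h2
    rwa [gp_ε, P₁_ε h, sub_self] at this
  have hA' : ∀ᶠ om in 𝓝[>] 0, |P.l * (P.ε * (1 - om)) / quadric P.l (P.ε * (1 - om)) - P.P₁ (P.ε * (1 - om))| < δ / 3 := by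
    have := (Metric.tendsto_nhds.1 hA) (δ / 3) (by linarith)
    filter_upwards [this] with om hom; rwa [Real.dist_eq, sub_zero] at hom
  -- `P₁(a₃) - fp₀(a₃) → 0`
  have hB1 : Tendsto (fun om => P.P₁ (P.η * (1 + om))) (𝓝[>] 0) (𝓝 P.c₁) := by
    rw [← P₁_η (P := P)]; exact tendsto_comp_one_add continuous_P₁.continuousAt
  have hB1' : ∀ᶠ om in 𝓝[>] 0, |P.P₁ (P.η * (1 + om)) - P.c₁| < δ / 6 := by
    have := (Metric.tendsto_nhds.1 hB1) (δ / 6) (by linarith)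
    filter_upwards [this] with om hom; rwa [Real.dist_eq] at hom
  have hB2' : ∀ᶠ om in 𝓝[>] 0, |P.fp om 0 (P.η * (1 + om)) - P.c₁| < δ / 6 := by
    filter_upwards [fp_win₂_tendsto h 0 (by linarith : 0 < δ / 6), self_mem_nhdsWithin] with om hom hom0
    have hom0' : 0 < om := hom0
    have hle : P.η * (1 - om) ≤ P.η * (1 + om) := by nlinarith [h.η_pos]
    exact hom _ ⟨hle, le_rfl⟩
  have hsmall : ∀ᶠ om : ℝ in 𝓝[>] 0, 0 < om ∧ om < min (1 / 8) (min (ρ1 / P.ε) (min (ρg / P.ε) (δ / (6 * P.ε * M + 1)))) :=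
    eventually_pos_lt (by positivity)
  filter_upwards [hA', hB1', hB2', hsmall] with om h1 h2 h3 h4
  obtain ⟨hom, hlt⟩ := h4
  simp only [lt_min_iff] at hlt
  obtain ⟨hom8, hρ1', hρg', hδ'⟩ := hlt
  set T := P.ε * (1 + om) with hT
  set b := P.ε * (1 - om) with hb
  set a := P.η * (1 + om) with ha
  have hbT : b ≤ T := by rw [hb, hT]; nlinarith
  have hσb : P.σ < b := by rw [hb]; nlinarith [h.σ_lt_ε, h.σ_pos]
  -- `fp₀(T) = fp₀(b) + ∫_b^T φ₀` and `g'(T) = g'(b) + ∫_b^T Q_g`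
  have hσx : ∀ x ∈ uIcc b T, P.σ < x := fun x hx => by rw [uIcc_of_le hbT] at hx; linarith [hx.1]
  have hI1 : ∫ x in b..T, P.φ om 0 x = P.fp om 0 T - P.fp om 0 b :=
    integral_eq_sub_of_hasDerivAt (fun x hx => hasDerivAt_fp h hom hom8.le 0 (hσx x hx))
      (((contDiffOn_phi h hom hom8.le 0 (n := ⊤)).continuousOn.mono fun x hx => hσx x hx).intervalIntegrable)
  have hI2 : ∫ x in b..T, P.Qg x = P.l * T / quadric P.l T - P.l * b / quadric P.l b :=
    integral_eq_sub_of_hasDerivAt (fun x _ => hasDerivAt_deriv_quadric hl x)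
      ((contDiff_Qg h (n := ⊤)).continuous.intervalIntegrable _ _)
  -- the window integral of `Q_g - φ₀` is small
  have hwin : ∀ x ∈ uIcc b T, |P.Qg x - P.φ om 0 x| ≤ M := by
    intro x hx
    rw [uIcc_of_le hbT] at hx
    have hxa : |x - P.ε| ≤ om * P.ε := by rw [abs_le]; constructor <;> nlinarith [hx.1, hx.2]
    have hx1' : |x - P.ε| < ρ1 := lt_of_le_of_lt hxa (by rwa [lt_div_iff₀ hε] at hρ1')
    have hxg' : |x - P.ε| < ρg := lt_of_le_of_lt hxa (by rwa [lt_div_iff₀ hε] at hρg')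
    rw [φ_win₃ h hom hom8.le 0 hx.1]
    have : P.Qg x - ((1 - window P.ε om x) * P.Q₁ x + window P.ε om x * P.Qg x) =
        (1 - window P.ε om x) * (P.Qg x - P.Q₁ x) := by ring
    rw [this, abs_mul, abs_of_nonneg (by linarith [@window_le_one P.ε om x])]
    calc (1 - window P.ε om x) * |P.Qg x - P.Q₁ x| ≤ 1 * |P.Qg x - P.Q₁ x| :=
          mul_le_mul_of_nonneg_right (by linarith [@window_nonneg P.ε om x]) (abs_nonneg _)
      _ ≤ |P.Qg x| + |P.Q₁ x| := by rw [one_mul]; exact abs_sub _ _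
      _ ≤ M := by rw [hM]; linarith [hb1 x hx1', hbg x hxg']
  have hiQg : IntervalIntegrable P.Qg volume b T := (contDiff_Qg h (n := ⊤)).continuous.intervalIntegrable _ _
  have hiφ : IntervalIntegrable (P.φ om 0) volume b T :=
    ((contDiffOn_phi h hom hom8.le 0 (n := ⊤)).continuousOn.mono fun x hx => hσx x hx).intervalIntegrable
  have hI3 : |∫ x in b..T, (P.Qg x - P.φ om 0 x)| ≤ M * |T - b| := abs_integral_le_of_abs_le hwin
  have hI3' : |∫ x in b..T, (P.Qg x - P.φ om 0 x)| < δ / 3 := by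
    have hlen : |T - b| = 2 * om * P.ε := by rw [hT, hb, abs_of_nonneg (by nlinarith)]; ring
    rw [hlen] at hI3
    have h4 : om * (6 * P.ε * M + 1) < δ := by rwa [lt_div_iff₀ (by positivity)] at hδ'
    nlinarith
  have hsplit : ∫ x in b..T, (P.Qg x - P.φ om 0 x) = (∫ x in b..T, P.Qg x) - ∫ x in b..T, P.φ om 0 x :=
    integral_sub hiQg hiφ
  -- the convex-region identity with `β = 0`
  have hconv := fp_convex_eq h hom hom8.le 0 (t := b)
    (by obtain ⟨-, s2, s3⟩ := h.sizes hom.le hom8.le; exact s2.trans s3) le_rfl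
  rw [zero_mul, add_zero] at hconv
  -- assemble
  rw [Real.dist_eq, sub_zero]
  have key : P.l * T / quadric P.l T - P.fp om 0 T =
      (∫ x in b..T, (P.Qg x - P.φ om 0 x)) + (P.l * b / quadric P.l b - P.P₁ b) +
        (P.P₁ a - P.fp om 0 a) := by
    rw [hsplit, hI1, hI2, hconv]; ring
  rw [key]
  have e1 := abs_add_three (∫ x in b..T, (P.Qg x - P.φ om 0 x)) (P.l * b / quadric P.l b - P.P₁ b)
    (P.P₁ a - P.fp om 0 a)
  have e2 : |P.P₁ a - P.fp om 0 a| < δ / 6 + δ / 6 :=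
    calc |P.P₁ a - P.fp om 0 a| = |(P.P₁ a - P.c₁) - (P.fp om 0 a - P.c₁)| := by ring_nf
      _ ≤ |P.P₁ a - P.c₁| + |P.fp om 0 a - P.c₁| := abs_sub _ _
      _ < δ / 6 + δ / 6 := add_lt_add h2 h3
  linarith

/-- **`β⋆ → 0` as `ω → 0⁺`.** [cite: ForstnericKozak2003, Prop. 3.1] -/
theorem βs_tendsto (h : P.Pos) : Tendsto P.βs (𝓝[>] 0) (𝓝 0) := by
  have hε := h.ε_pos
  rw [Metric.tendsto_nhds]
  intro δ hδ
  have h1 := (Metric.tendsto_nhds.1 (discrepancy_T_tendsto h)) (δ * (P.ε / 12)) (by positivity)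
  filter_upwards [h1, self_mem_nhdsWithin] with om hom hom0
  have hom0 : 0 < om := hom0
  rw [Real.dist_eq, sub_zero] at hom ⊢
  have hI := Iψ_pos h hom0
  have hI0 : 0 < P.Iψ om := lt_of_lt_of_le (by positivity) hI
  rw [βs, abs_div, abs_of_pos hI0, div_lt_iff₀ hI0]
  calc |P.l * (P.ε * (1 + om)) / quadric P.l (P.ε * (1 + om)) - P.fp om 0 (P.ε * (1 + om))|
      < δ * (P.ε / 12) := hom
    _ ≤ δ * P.Iψ om := mul_le_mul_of_nonneg_left hI hδ.le

/-- **`fp ω β⋆ → g'(ε)` uniformly on the third window as `ω → 0⁺`.** [cite: ForstnericKozak2003, Prop. 3.1] -/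
theorem fp_win₃_tendsto (h : P.Pos) {δ : ℝ} (hδ : 0 < δ) :
    ∀ᶠ om in 𝓝[>] 0, ∀ t ∈ Icc (P.ε * (1 - om)) (P.ε * (1 + om)), |P.fp om (P.βs om) t - P.gpε| < δ := by
  have hε := h.ε_pos
  have hl := h.l_nonneg
  obtain ⟨hcQ1, hcQg, hcg, hcP1⟩ := continuousAt_ε h
  obtain ⟨ρ1, hρ1, hb1⟩ := exists_abs_le_near hcQ1
  obtain ⟨ρg, hρg, hbg⟩ := exists_abs_le_near hcQg
  set M := |P.Q₁ P.ε| + 1 + (|P.Qg P.ε| + 1) with hM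
  have hM0 : 0 < M := by rw [hM]; positivity
  -- the four small quantities
  have hP1b : ∀ᶠ om in 𝓝[>] 0, |P.P₁ (P.ε * (1 - om)) - P.gpε| < δ / 5 := by
    have := (Metric.tendsto_nhds.1 (tendsto_comp_one_sub hcP1)) (δ / 5) (by linarith)
    filter_upwards [this] with om hom; rwa [Real.dist_eq, P₁_ε h] at hom
  have hP1a : ∀ᶠ om in 𝓝[>] 0, |P.P₁ (P.η * (1 + om)) - P.c₁| < δ / 5 := by
    have hB1 : Tendsto (fun om => P.P₁ (P.η * (1 + om))) (𝓝[>] 0) (𝓝 P.c₁) := by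
      rw [← P₁_η (P := P)]; exact tendsto_comp_one_add continuous_P₁.continuousAt
    have := (Metric.tendsto_nhds.1 hB1) (δ / 5) (by linarith)
    filter_upwards [this] with om hom; rwa [Real.dist_eq] at hom
  have hfa : ∀ᶠ om in 𝓝[>] 0, |P.fp om 0 (P.η * (1 + om)) - P.c₁| < δ / 5 := by
    filter_upwards [fp_win₂_tendsto h 0 (by linarith : 0 < δ / 5), self_mem_nhdsWithin] with om hom hom0
    have hom0' : 0 < om := hom0
    have hle : P.η * (1 - om) ≤ P.η * (1 + om) := by nlinarith [h.η_pos]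
    exact hom _ ⟨hle, le_rfl⟩
  have hβ : ∀ᶠ om in 𝓝[>] 0, |P.βs om| < δ / (5 * P.ε) := by
    have := (Metric.tendsto_nhds.1 (βs_tendsto h)) (δ / (5 * P.ε)) (by positivity)
    filter_upwards [this] with om hom; rwa [Real.dist_eq, sub_zero] at hom
  have hsmall : ∀ᶠ om : ℝ in 𝓝[>] 0, 0 < om ∧ om < min (1 / 8) (min (ρ1 / P.ε) (min (ρg / P.ε) (δ / (10 * P.ε * M + 1)))) :=
    eventually_pos_lt (by positivity)
  filter_upwards [hP1b, hP1a, hfa, hβ, hsmall] with om h1 h2 h3 h4 h5 t ht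
  obtain ⟨hom, hlt⟩ := h5
  simp only [lt_min_iff] at hlt
  obtain ⟨hom8, hρ1', hρg', hδ'⟩ := hlt
  set b := P.ε * (1 - om) with hb
  set a := P.η * (1 + om) with ha
  obtain ⟨s1, s2, s3⟩ := h.sizes hom.le hom8.le
  have hab : a ≤ b := s2.trans s3
  have hσa : P.σ < a := by
    have := h.t₂_pos; rw [t₂_eq] at s1 this; rw [ha]; nlinarith [h.η_pos]
  have hσb : P.σ < b := lt_of_lt_of_le hσa hab
  -- `fp t = fp b + ∫_b^t φ`
  have hσx : ∀ x ∈ uIcc b t, P.σ < x := fun x hx => by rw [uIcc_of_le ht.1] at hx; linarith [hx.1]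
  have hI1 : ∫ x in b..t, P.φ om (P.βs om) x = P.fp om (P.βs om) t - P.fp om (P.βs om) b :=
    integral_eq_sub_of_hasDerivAt (fun x hx => hasDerivAt_fp h hom hom8.le _ (hσx x hx))
      (((contDiffOn_phi h hom hom8.le _ (n := ⊤)).continuousOn.mono fun x hx => hσx x hx).intervalIntegrable)
  have hwin : ∀ x ∈ uIcc b t, |P.φ om (P.βs om) x| ≤ M := by
    intro x hx
    rw [uIcc_of_le ht.1] at hx
    have hx2 : x ≤ P.ε * (1 + om) := hx.2.trans ht.2
    have hxa : |x - P.ε| ≤ om * P.ε := by rw [abs_le]; constructor <;> nlinarith [hx.1, hx2]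
    have hx1' : |x - P.ε| < ρ1 := lt_of_le_of_lt hxa (by rwa [lt_div_iff₀ hε] at hρ1')
    have hxg' : |x - P.ε| < ρg := lt_of_le_of_lt hxa (by rwa [lt_div_iff₀ hε] at hρg')
    rw [φ_win₃ h hom hom8.le _ hx.1]
    exact (abs_glue_le (window_nonneg x) (window_le_one x)).trans (by rw [hM]; linarith [hb1 x hx1', hbg x hxg'])
  have hI2 : |∫ x in b..t, P.φ om (P.βs om) x| < δ / 5 := by
    have h6 := abs_integral_le_of_abs_le hwin
    have hlen : |t - b| ≤ 2 * om * P.ε := by rw [abs_of_nonneg (by linarith [ht.1])]; rw [hb]; nlinarith [ht.2]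
    have h7 : om * (10 * P.ε * M + 1) < δ := by rwa [lt_div_iff₀ (by positivity)] at hδ'
    nlinarith [mul_le_mul_of_nonneg_left hlen hM0.le]
  -- `fp b = fp a + P₁ b - P₁ a + β ∫_a^b ψ`, `fp a = fp₀ a`
  have hconv := fp_convex_eq h hom hom8.le (P.βs om) (t := b) hab le_rfl
  have hinda : P.fp om (P.βs om) a = P.fp om 0 a := fp_indep_β h hom hom8.le _ hσa s2
  have hψI : |P.βs om * ∫ x in a..b, P.ψ x| < δ / 5 := by
    have h8 : |∫ x in a..b, P.ψ x| ≤ 1 * |b - a| :=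
      abs_integral_le_of_abs_le fun x _ => by rw [abs_of_nonneg (ψ_nonneg x)]; exact ψ_le_one x
    have h9 : |b - a| ≤ P.ε := by rw [abs_of_nonneg (by linarith)]; rw [hb, ha]; nlinarith [h.η_pos]
    rw [abs_mul]
    have h10 : |∫ x in a..b, P.ψ x| ≤ P.ε := by linarith
    calc |P.βs om| * |∫ x in a..b, P.ψ x| ≤ |P.βs om| * P.ε :=
          mul_le_mul_of_nonneg_left h10 (abs_nonneg _)
      _ < δ / (5 * P.ε) * P.ε := mul_lt_mul_of_pos_right h4 hε
      _ = δ / 5 := by field_simp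
  have key : P.fp om (P.βs om) t - P.gpε =
      (∫ x in b..t, P.φ om (P.βs om) x) + (P.fp om 0 a - P.c₁) + (P.P₁ b - P.gpε) - (P.P₁ a - P.c₁) +
        P.βs om * ∫ x in a..b, P.ψ x := by
    rw [hI1, hconv, hinda]; ring
  rw [key]
  have e1 := abs_add_three ((∫ x in b..t, P.φ om (P.βs om) x) + (P.fp om 0 a - P.c₁) + (P.P₁ b - P.gpε))
    (-(P.P₁ a - P.c₁)) (P.βs om * ∫ x in a..b, P.ψ x)
  have e2 := abs_add_three (∫ x in b..t, P.φ om (P.βs om) x) (P.fp om 0 a - P.c₁) (P.P₁ b - P.gpε)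
  rw [abs_neg] at e1
  have e3 : (∫ x in b..t, P.φ om (P.βs om) x) + (P.fp om 0 a - P.c₁) + (P.P₁ b - P.gpε) - (P.P₁ a - P.c₁) +
      P.βs om * ∫ x in a..b, P.ψ x =
      (∫ x in b..t, P.φ om (P.βs om) x) + (P.fp om 0 a - P.c₁) + (P.P₁ b - P.gpε) + -(P.P₁ a - P.c₁) +
      P.βs om * ∫ x in a..b, P.ψ x := by ring
  rw [e3]
  linarith

end HParam

end Literature.Geometry.Symplectic

end
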